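import Summits.CriticalPhenomena.PercolationContinuityZ3.Theorems.Transplant.SqShadowDefs
import Summits.CriticalPhenomena.PercolationContinuityZ3.Theorems.Transplant.VPathKit
import Mathlib.Combinatorics.SimpleGraph.Prod
import HarnessLib

/-!
# `F □ ℤ²`, p205010-free routing II: SELF-AVOIDING PATHS IN THE PRODUCT — fibre paths in a column, planar legs at a fixed fibre level, and the LEG LIFT that
# descends in the last-but-one column (the vertex-disjointness of lifted legs then follows from the COLUMN-disjointness of the planar legs, for ARBITRARY `F`)

builds on p205010 (kernel theorem, internal audit signed; external expert review pending) — NOT used in this file.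
Lane `prim-bschramm`, seat `prim-bschramm-p2` (gen 50; class C1b, METHOD = input substitution; memo `HOME/bschramm/P2-LATTICES.md` §161); helper file
(`--supports stmt-CriticalPhenomena-4575 --as helper`).
* §1 the fibre: `exists_gpath` (a self-avoiding `F`-path between any two vertices of a connected `F`), `exists_gpath_three_le` (of `≥ 3` vertices between distinct
  non-adjacent ones), `exists_third_adj` (next to an edge `g₁ ∼ g₂` of a connected `F` with a third vertex there is a third vertex adjacent to `g₁` or `g₂`,
  Mathlib `Walk.exists_boundary_dart`), `Fork` (a vertex with two distinct neighbours) and `exists_fork` (every connected `F` with three distinct vertices);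
* §2 the product: `GPath.mapEmb` (transport along a graph embedding), the column path `col q L` and the level path `lev g π` («VPathKit».`GPath` of
  `F □ ℤ²` from a `GPath` of `F` / of `ℤ²`; Mathlib `boxProdLeft` / `boxProdRight`), their columns and levels;
* §3 **`exists_liftLeg`**: a planar self-avoiding leg `π : p ⇝ a` of `≥ 2` columns, a fibre level `x` and a target vertex `(g, a)` give a self-avoiding path of
  `F □ ℤ²` from `(x, p)` to `(g, a)` over the columns of `π`, at level `x` except over the last-but-one column (where it runs through an `F`-path `x ⇝ g`) and over
  `a` (visited only at the end vertex).
[cite: DuminilCopinSidoraviciusTassion2016, §2.3 (proof of Fact 2: the three disjoint self-avoiding paths in B̄_R(z))]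
-/

noncomputable section

namespace Summit.CriticalPhenomena.PercolationContinuityZ3.Theorems.Transplant

/-! ## §2 (generic part) Transport of self-avoiding paths along a graph embedding -/

namespace GPath

open SimpleGraph

/-- **Transport of a self-avoiding path along a graph EMBEDDING** (as «VPathKit».`GPath.map` for isomorphisms). [folklore] -/
theorem mapEmb {V V' : Type} {G : SimpleGraph V} {G' : SimpleGraph V'} {l : List V} {s t : V} (φ : G ↪g G') (h : GPath G l s t) :
    GPath G' (l.map φ) (φ s) (φ t) where
  ne_nil := by simpa using h.ne_nil
  chain := by rw [List.isChain_map]; exact h.chain.imp fun a b hab => φ.map_adj_iff.2 hab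
  nodup := h.nodup.map φ.injective
  head := by rw [List.head?_map, h.head]; rfl
  last := by rw [List.getLast?_map, h.last]; rfl

/-- The length of a path between distinct vertices is at least two. [folklore] -/
theorem two_le_length {V : Type} {G : SimpleGraph V} {l : List V} {s t : V} (h : GPath G l s t) (hst : s ≠ t) : 2 ≤ l.length := by
  rw [h.eq_cons_dropLast_concat hst]; simp

end GPath

namespace FinProdZ2

open SimpleGraph Literature.Probability.Percolation Literature.Probability.LatticeModels
open scoped Classical

variable {W : Type} (F : SimpleGraph W)

/-! ## §1 The fibre: self-avoiding `F`-paths, a third neighbour, forks -/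

/-- **A self-avoiding `F`-path between any two vertices of a connected graph** (Mathlib: a walk, made a path by `toPath`). [folklore] -/
theorem exists_gpath (hF : F.Connected) (x y : W) : ∃ L : List W, GPath F L x y := by
  obtain ⟨w⟩ := hF.preconnected x y
  set p : F.Path x y := w.toPath with hp
  refine ⟨(p : F.Walk x y).support, Walk.support_ne_nil _, Walk.isChain_adj_support _, p.2.support_nodup, ?_, ?_⟩
  · rw [List.head?_eq_some_head (Walk.support_ne_nil _), Walk.head_support]
  · rw [List.getLast?_eq_some_getLast (Walk.support_ne_nil _), Walk.getLast_support]

/-- Between DISTINCT NON-ADJACENT vertices every self-avoiding path has at least three vertices. [folklore] -/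
theorem three_le_length_of_not_adj {L : List W} {x y : W} (h : GPath F L x y) (hxy : x ≠ y) (hn : ¬ F.Adj x y) : 3 ≤ L.length := by
  have h2 := h.two_le_length hxy
  by_contra hlt
  have hlen : L.length = 2 := by omega
  obtain ⟨a, b, rfl⟩ : ∃ a b, L = [a, b] := by
    match L, hlen with
    | [a, b], _ => exact ⟨a, b, rfl⟩
  have ha : a = x := by simpa using h.head
  have hb : b = y := by simpa using h.last
  subst ha hb
  have := h.chain
  rw [List.isChain_cons_cons] at this
  exact hn this.1

/-- A self-avoiding `F`-path with at least three vertices between distinct non-adjacent vertices of a connected `F`. [folklore] -/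
theorem exists_gpath_three_le (hF : F.Connected) {x y : W} (hxy : x ≠ y) (hn : ¬ F.Adj x y) : ∃ L : List W, GPath F L x y ∧ 3 ≤ L.length := by
  obtain ⟨L, hL⟩ := exists_gpath F hF x y
  exact ⟨L, hL, three_le_length_of_not_adj F hL hxy hn⟩

/-- **Next to an edge there is a third neighbour**: in a connected graph with a vertex `t ∉ {g₁, g₂}`, some vertex `h ∉ {g₁, g₂}` is adjacent to `g₁` or to `g₂`
(the first dart of a walk `g₂ ⇝ t` leaving `{g₁, g₂}`). [folklore] -/
theorem exists_third_adj (hF : F.Connected) {g₁ g₂ t : W} (ht1 : t ≠ g₁) (ht2 : t ≠ g₂) :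
    ∃ h : W, h ≠ g₁ ∧ h ≠ g₂ ∧ (F.Adj g₁ h ∨ F.Adj g₂ h) := by
  obtain ⟨w⟩ := hF.preconnected g₂ t
  obtain ⟨d, -, hd1, hd2⟩ := w.exists_boundary_dart ({g₁, g₂} : Set W) (by simp) (by simp [ht1, ht2])
  simp only [Set.mem_insert_iff, Set.mem_singleton_iff, not_or] at hd1 hd2
  refine ⟨d.snd, hd2.1, hd2.2, ?_⟩
  rcases hd1 with h | h
  · exact Or.inl (h ▸ d.adj)
  · exact Or.inr (h ▸ d.adj)

/-- **A fork of `F`**: a vertex `c` with two distinct neighbours `a`, `b` (the three fibre levels of the hub of «ProdZ2HubRoute»). [folklore] -/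
structure Fork (c a b : W) : Prop where
  /-- first edge -/
  hca : F.Adj c a
  /-- second edge -/
  hcb : F.Adj c b
  /-- distinct ends -/
  hab : a ≠ b

namespace Fork

variable {F} {c a b : W} (φ : Fork F c a b)
include φ

/-- The centre differs from the first end. [folklore] -/
theorem ne₁ : c ≠ a := φ.hca.ne

/-- The centre differs from the second end. [folklore] -/
theorem ne₂ : c ≠ b := φ.hcb.ne

/-- The mirror fork. [folklore] -/
theorem symm : Fork F c b a := ⟨φ.hcb, φ.hca, φ.hab.symm⟩

end Fork

/-- **Every connected graph with three distinct vertices has a fork** (a shortest detour: if `x ∼ y` take a third neighbour of the edge; otherwise the second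
vertex of a path `x ⇝ y` of `≥ 3` vertices has two distinct neighbours on it). [folklore] -/
theorem exists_fork (hF : F.Connected) {x y t : W} (hxy : x ≠ y) (htx : t ≠ x) (hty : t ≠ y) : ∃ c a b : W, Fork F c a b := by
  by_cases hadj : F.Adj x y
  · obtain ⟨h, h1, h2, h3 | h3⟩ := exists_third_adj F hF htx hty
    · exact ⟨x, y, h, hadj, h3, h2.symm⟩
    · exact ⟨y, x, h, hadj.symm, h3, h1.symm⟩
  · obtain ⟨L, hL, h3⟩ := exists_gpath_three_le F hF hxy hadj
    obtain ⟨a, b, c, rest, rfl⟩ : ∃ a b c rest, L = a :: b :: c :: rest := by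
      match L, h3 with
      | a :: b :: c :: rest, _ => exact ⟨a, b, c, rest, rfl⟩
    have hch := hL.chain
    rw [List.isChain_cons_cons, List.isChain_cons_cons] at hch
    have hnd := hL.nodup
    have hac : a ≠ c := by
      intro e; subst e; simp at hnd
    exact ⟨b, a, c, hch.1.symm, hch.2.1, hac⟩

/-! ## §2 The product: column paths and level paths -/

/-- **The column path** over the column `q`: an `F`-path run inside `{·} × {q}`. [folklore] -/
def col (q : Site 2) (L : List W) : List (W × Site 2) := L.map fun g => (g, q)

/-- **The level path** at fibre level `g`: a planar path run inside `{g} × ℤ²`. [folklore] -/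
def lev (g : W) (π : List (Site 2)) : List (W × Site 2) := π.map fun x => (g, x)

omit F in
/-- Membership in a column path. [folklore] -/
@[simp] theorem mem_col {q : Site 2} {L : List W} {v : W × Site 2} : v ∈ col q L ↔ v.1 ∈ L ∧ v.2 = q := by
  constructor
  · rintro h
    obtain ⟨g, hg, rfl⟩ := List.mem_map.1 h
    exact ⟨hg, rfl⟩
  · rintro ⟨h1, h2⟩
    exact List.mem_map.2 ⟨v.1, h1, by rw [← h2]⟩

omit F in
/-- Membership in a level path. [folklore] -/
@[simp] theorem mem_lev {g : W} {π : List (Site 2)} {v : W × Site 2} : v ∈ lev g π ↔ v.1 = g ∧ v.2 ∈ π := by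
  constructor
  · rintro h
    obtain ⟨x, hx, rfl⟩ := List.mem_map.1 h
    exact ⟨rfl, hx⟩
  · rintro ⟨h1, h2⟩
    exact List.mem_map.2 ⟨v.2, h2, by rw [← h1]⟩

/-- **A column path is a self-avoiding path of `F □ ℤ²`** (Mathlib's embedding `boxProdLeft`). [folklore] -/
theorem gpath_col {q : Site 2} {L : List W} {x y : W} (h : GPath F L x y) : GPath (F □ zdGraph 2) (col q L) (x, q) (y, q) :=
  h.mapEmb (F.boxProdLeft (zdGraph 2) q)

/-- **A level path is a self-avoiding path of `F □ ℤ²`** (Mathlib's embedding `boxProdRight`). [folklore] -/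
theorem gpath_lev {g : W} {π : List (Site 2)} {a b : Site 2} (h : GPath (zdGraph 2) π a b) : GPath (F □ zdGraph 2) (lev g π) (g, a) (g, b) :=
  h.mapEmb (F.boxProdRight (zdGraph 2) g)

/-! ## §3 The leg lift: descend in the last-but-one column -/

/-- **THE LEG LIFT.**  A planar self-avoiding leg `π : p ⇝ a` with at least two columns, a fibre level `x` and a target level `g`: there is a self-avoiding path of
`F □ ℤ²` from `(x, p)` to `(g, a)` (the leg at level `x` up to its last-but-one column `n`, an `F`-path `x ⇝ g` over `n`, the last planar step at level `g`) whose
columns lie on `π`, which visits the column `a` only at its end vertex `(g, a)`, and whose vertices over columns other than `n` and `a` have level `x`; the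
last-but-one column `n` is on `π` and differs from `a`. [cite: DuminilCopinSidoraviciusTassion2016, §2.3 (proof of Fact 2: the paths γ_u, γ_v, γ_w)] -/
theorem exists_liftLeg (hF : F.Connected) {π : List (Site 2)} {p a : Site 2} (hπ : GPath (zdGraph 2) π p a) (h2 : 2 ≤ π.length) (x g : W) :
    ∃ (L : List (W × Site 2)) (n : Site 2), GPath (F □ zdGraph 2) L (x, p) (g, a) ∧ n ∈ π ∧ n ≠ a ∧
      (∀ v ∈ L, v.2 ∈ π) ∧ (∀ v ∈ L, v.2 = a → v = (g, a)) ∧ (∀ v ∈ L, v.2 ≠ n → v.2 ≠ a → v.1 = x) := by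
  have hpa : p ≠ a := by
    intro e; subst e
    have := hπ.eq_cons_dropLast_concat
    -- a path with ≥ 2 vertices from `p` to `p` would repeat `p`
    have hnd := hπ.nodup
    obtain ⟨q, rest, hq⟩ : ∃ q rest, π = p :: q :: rest := by
      match π, h2, hπ.head with
      | b :: c :: rest, _, hh => exact ⟨c, rest, by simp at hh; rw [hh]⟩
    rw [hq] at hnd
    have hlast := hπ.last
    rw [hq, List.getLast?_eq_some_getLast (by simp)] at hlast
    simp only [Option.some.injEq] at hlast
    have hmem : p ∈ q :: rest := by rw [← hlast]; exact List.getLast_mem _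
    exact (List.nodup_cons.1 hnd).1 hmem
  -- split off the last column: `π = π₀ ++ [a]`, `π₀ : p ⇝ n` non-empty
  set π₀ : List (Site 2) := π.dropLast with hπ₀
  have hsplit : π = π₀ ++ [a] := by
    rw [hπ₀]; conv_lhs => rw [← List.dropLast_append_getLast hπ.ne_nil, hπ.getLast_eq]
  have hπ₀ne : π₀ ≠ [] := by
    intro h0; rw [h0, List.nil_append] at hsplit; rw [hsplit] at h2; simp at h2
  set n : Site 2 := π₀.getLast hπ₀ne with hn
  -- `π₀` is a planar path from `p` to `n`, `n ∼ a`, `a ∉ π₀`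
  have hch := hπ.chain
  rw [hsplit, List.isChain_append] at hch
  obtain ⟨hch₀, -, hna⟩ := hch
  have hna' : (zdGraph 2).Adj n a := hna n (by rw [hn]; exact List.getLast?_eq_some_getLast hπ₀ne |>.symm ▸ rfl) a (by simp)
  have hnd := hπ.nodup
  rw [hsplit, List.nodup_append] at hnd
  obtain ⟨hnd₀, -, hdisj⟩ := hnd
  have haπ₀ : a ∉ π₀ := fun h => hdisj a h a (by simp) rfl
  have hnπ₀ : n ∈ π₀ := by rw [hn]; exact List.getLast_mem _
  have hna_ne : n ≠ a := fun e => haπ₀ (e ▸ hnπ₀)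
  have hP₀ : GPath (zdGraph 2) π₀ p n := by
    refine ⟨hπ₀ne, hch₀, hnd₀, ?_, by rw [hn]; exact List.getLast?_eq_some_getLast hπ₀ne⟩
    have := hπ.head
    rw [hsplit, List.head?_append] at this
    cases h0 : π₀.head? with
    | none => exact absurd (List.head?_eq_none_iff.1 h0) hπ₀ne
    | some b => rw [h0] at this; simpa using this
  -- the fibre path over `n`
  obtain ⟨P, hP⟩ := exists_gpath F hF x g
  -- assemble: level leg to `(x, n)`, column path to `(g, n)`, last step to `(g, a)`
  have hA : GPath (F □ zdGraph 2) (lev x π₀) (x, p) (x, n) := gpath_lev F hP₀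
  have hB : GPath (F □ zdGraph 2) (col n P) (x, n) (g, n) := gpath_col F hP
  have hAB : GPath (F □ zdGraph 2) (lev x π₀ ++ (col n P).tail) (x, p) (g, n) := by
    refine hA.trans hB fun v hvB hvA => ?_
    rw [mem_col] at hvB; rw [mem_lev] at hvA
    exact Prod.ext hvA.1 hvB.2
  have hstep : (F □ zdGraph 2).Adj (g, n) (g, a) := by
    rw [boxProd_adj]; exact Or.inr ⟨hna', rfl⟩
  have hC : GPath (F □ zdGraph 2) [(g, n), (g, a)] (g, n) (g, a) := GPath.pair hstep
  have hmemAB : ∀ v ∈ lev x π₀ ++ (col n P).tail, v.2 ∈ π₀ := by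
    intro v hv
    rcases List.mem_append.1 hv with hv | hv
    · exact (mem_lev.1 hv).2
    · have := mem_col.1 (List.tail_subset _ hv); rw [this.2]; exact hnπ₀
  have hL : GPath (F □ zdGraph 2) ((lev x π₀ ++ (col n P).tail) ++ [(g, n), (g, a)].tail) (x, p) (g, a) := by
    refine hAB.trans hC fun v hvC hvAB => ?_
    rcases List.mem_cons.1 hvC with rfl | hvC
    · rfl
    · rw [List.mem_singleton] at hvC; subst hvC
      exact absurd (hmemAB _ hvAB) haπ₀
  refine ⟨(lev x π₀ ++ (col n P).tail) ++ [(g, n), (g, a)].tail, n, hL, by rw [hsplit]; exact List.mem_append_left _ hnπ₀, hna_ne, ?_, ?_, ?_⟩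
  · intro v hv
    rcases List.mem_append.1 hv with hv | hv
    · rw [hsplit]; exact List.mem_append_left _ (hmemAB v hv)
    · simp only [List.tail_cons, List.mem_singleton] at hv; subst hv; exact hπ.last_mem
  · intro v hv hva
    rcases List.mem_append.1 hv with hv | hv
    · exact absurd (hva ▸ hmemAB v hv) haπ₀
    · simpa using hv
  · intro v hv hvn hva
    rcases List.mem_append.1 hv with hv | hv
    · rcases List.mem_append.1 hv with hv | hv
      · exact (mem_lev.1 hv).1
      · exact absurd (mem_col.1 (List.tail_subset _ hv)).2 hvn
    · simp only [List.tail_cons, List.mem_singleton] at hv; subst hv; exact absurd rfl hva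

end FinProdZ2

end Summit.CriticalPhenomena.PercolationContinuityZ3.Theorems.Transplant

end
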